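import Literature.Computability.Cryptography.InaccessibleEntropyUOWHFParams
import Literature.Computability.Cryptography.AffineHashProgram
import Literature.Computability.Complexity.FoldCatBricks
import Literature.Computability.Complexity.BitCodecs
import Literature.Computability.Complexity.KannanLanguage
import Literature.Computability.Learning.GLStageFP
import HarnessLib

/-!
# One-way functions ⇒ UOWHF, machine layer II: the candidate hash functions as `FP` string functions

Topic `Literature/Computability/Cryptography`; tenth file of the "one-way functions ⇒ universal one-way
hash functions" line (Haitner–Holenstein–Reingold–Vadhan–Wee, *Inaccessible Entropy II*, Theory of
Computing 16(8), 2020, proof of Thm. 5.1; sizes in `InaccessibleEntropyUOWHFParams.lean`). For a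
length-preserving `f : {0,1}* → {0,1}*` and the security parameter `n` (the input length of `f`) this file
writes the maps of Steps 1–4 of the proof of Thm. 5.1 twice — as total **string functions** (the
semantics the later files reason about) and as **bricks** of the `FP` string algebra taking `⟨1ⁿ, ·⟩`
(and `⟨1ⁿ, ⟨1ʲ, ·⟩⟩` for the candidate of grid index `j`) — and proves that the bricks compute the string
functions on every input and are polynomial time when `f` is:

* `blockStr f n z` — the base function `F(x, κ, i) = (h_κ(f x)_{1…i} 0^{M−i}, κ, i)` of Thm. 4.5 on one
  `d₀`-bit block `z = x κ i` (`x`: `n` bits, `κ`: `ℓK` bits keying the affine hash `{0,1}ⁿ → {0,1}^M` of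
  `AffineHashStrings.lean`, `i`: `a` bits read as a binary numeral), `blk` bits out; brick `blockP`;
* `F1Str f n w` — Step 1, `F₁ = Fᵗ` blockwise on `w ∈ {0,1}^{t·d₀}`; brick `F1P` (a `foldCat`);
* `F2Str f n j v` — Step 2, `F₂(w, g₂) = (F₁ w, g₂, g₂(w) 0^{ℓmax−ℓ_j})` (entropy smoothing by the affine hash
  `{0,1}^{t d₀} → {0,1}^{ℓ_j}`, `ℓ_j = u(2j−5)`, keyed by the first `ℓ_j(t d₀+1)` bits of `g₂`, padded to the
  fixed width `ℓmax`); brick `F2P`;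
* `F3Str f n j v` — Step 3, `F₃(u, g₃) = (g₃, g₃(F₂ u))` (the affine hash `{0,1}^{m₂} → {0,1}^{n₂−1}`),
  mapping `N` bits to `N − 1`; brick `F3P`;
* `candStr f n j y x = F₃(y ⊕ x)` — Step 4, the keyed candidate `G_y(x)`; brick `candP`.

Design: every brick reads its sizes from the unary field `1ⁿ` through the compiled size expressions of
the parameter table (`szF`, `UnaryExprBricks.lean`), so no arithmetic is re-proved here; the string
functions are total (short or long inputs are cut and padded by `take`), which is what makes the
`FP` growth bookkeeping uniform (`length_blockStr_le` etc.). The correspondence with the abstract maps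
`baseF`, `prodMap`, `hashIn`, `hashOut`, `CandData.fam` of `InaccessibleEntropyUOWHF.lean` (on well-formed
inputs, through explicit parsing bijections) is the subject of the next file.

## References

* I. Haitner, T. Holenstein, O. Reingold, S. Vadhan, H. Wee, *Inaccessible Entropy II: IE Functions and
  Universal One-Way Hashing*, Theory of Computing 16(8) (2020), Thm. 4.5 (the function `F`), proof of
  Thm. 5.1, Steps 1–4 ("Note that all these steps are polynomial-time computable").
* O. Goldreich, *Foundations of Cryptography II*, CUP 2004, §6.4.3.2 (Thm. 6.4.29).
-/

namespace Literature.Computability.Cryptography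

namespace HHRVW

open _root_.Computability Complexity Complexity.Brick Complexity.Plumb Complexity.UExpr AffineStr Sz
open Complexity.BitCodec (length_ccat_blocks ccat_block ccat_of_blocks)

/-! ### Cutting and padding to a prescribed length -/

/-- `fitLen m y = y ↾ m` padded with zeros to length `m`. [folklore] -/
def fitLen (m : ℕ) (y : List Bool) : List Bool := y.take m ++ List.replicate (m - y.length) false

/-- `|fitLen m y| = m`. [folklore] -/
@[simp] theorem length_fitLen (m : ℕ) (y : List Bool) : (fitLen m y).length = m := by
  simp only [fitLen, List.length_append, List.length_take, List.length_replicate]; omega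

/-- `fitLen m y = y` when `|y| = m`. [folklore] -/
theorem fitLen_of_length_eq {m : ℕ} {y : List Bool} (h : y.length = m) : fitLen m y = y := by
  rw [fitLen, List.take_of_length_le h.le, ← h, Nat.sub_self, List.replicate_zero, List.append_nil]

/-- `fitLen` is injective on strings of length `m`. [folklore] -/
theorem fitLen_inj {m : ℕ} {y y' : List Bool} (hy : y.length = m) (hy' : y'.length = m) (h : fitLen m y = fitLen m y') :
    y = y' := by rwa [fitLen_of_length_eq hy, fitLen_of_length_eq hy'] at h

/-! ### The string functions -/

section Semantics

variable (f : List Bool → List Bool) (n : ℕ)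

/-- **The base function on one block** `z = x κ i` (`n + ℓK + a` bits):
`(h_κ(f x) ↾ i) 0^{M−i} ++ κ ++ i`, where `i` is the numeral of the last `a` bits (so `i < 2^a = M`).
[cite: HaitnerEtAl2020, Thm. 4.5 (the function `F(x, g, i) = (g(f(x))_{1,…,i}, g, i)`)] -/
def blockStr (z : List Bool) : List Bool :=
  fitLen (M n) ((hashStr n (M n) ((z.drop n).take (lK n)) (f (z.take n))).take (bitsToNat ((z.drop (n + lK n)).take (a n)))) ++
    ((z.drop n).take (lK n) ++ (z.drop (n + lK n)).take (a n))

/-- **Step 1**: `F₁ = Fᵗ`, blockwise on `t` blocks of `d₀` bits. [cite: HaitnerEtAl2020, proof of Thm. 5.1, Step 1] -/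
def F1Str (w : List Bool) : List Bool :=
  ccat (fun b => blockStr f n ((w.drop (b * d0 n)).take (d0 n))) (t n)

/-- **Step 2** for grid index `j`: on `v = w g₂` (`t·d₀ + |G₂|` bits),
`F₁ w ++ g₂ ++ g₂(w) 0^{ℓmax − ℓ_j}` (the smoothing hash has `ℓ_j` output bits, read off the first `ℓ_j(t d₀ + 1)` key
bits, and is padded to the fixed width `ℓmax`). [cite: HaitnerEtAl2020, proof of Thm. 5.1, Step 2] -/
def F2Str (j : ℕ) (v : List Bool) : List Bool :=
  F1Str f n (v.take (t n * d0 n)) ++ ((v.drop (t n * d0 n)).take (G2 n) ++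
    fitLen (lmax n) (hashStr (t n * d0 n) (ell n j) ((v.drop (t n * d0 n)).take (G2 n)) (v.take (t n * d0 n))))

/-- **Step 3** for grid index `j`: on `v = u g₃` (`N = n₂ + |G₃|` bits), `g₃ ++ g₃(F₂ u)` (`N − 1` bits).
[cite: HaitnerEtAl2020, proof of Thm. 5.1, Step 3] -/
def F3Str (j : ℕ) (v : List Bool) : List Bool :=
  (v.drop (n2 n)).take (G3 n) ++ hashStr (m2 n) (r3 n) ((v.drop (n2 n)).take (G3 n)) (F2Str f n j (v.take (n2 n)))

/-- **Step 4** for grid index `j`: the keyed candidate `G_y(x) = F₃(y ⊕ x)` on `N`-bit strings.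
[cite: HaitnerEtAl2020, proof of Thm. 5.1, Step 4] -/
def candStr (j : ℕ) (y x : List Bool) : List Bool := F3Str f n j (List.zipWith xor y x)

variable {f n}

/-- `|blockStr z| ≤ blk n` on every input. [folklore] -/
theorem length_blockStr_le (z : List Bool) : (blockStr f n z).length ≤ blk n := by
  simp only [blockStr, List.length_append, length_fitLen, List.length_take, blk]; omega

/-- `|blockStr z| = blk n` on inputs of length at least `d₀`. [folklore] -/
theorem length_blockStr {z : List Bool} (hz : d0 n ≤ z.length) : (blockStr f n z).length = blk n := by
  simp only [blockStr, List.length_append, length_fitLen, List.length_take, List.length_drop, blk]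
  have : d0 n = n + lK n + a n := rfl
  omega

/-- `|F1Str w| = t·blk`. [folklore] -/
theorem length_F1Str {w : List Bool} (hw : w.length = t n * d0 n) : (F1Str f n w).length = t n * blk n :=
  length_ccat_blocks fun b hb => length_blockStr (by
    rw [List.length_take, List.length_drop, hw, min_eq_left]
    rw [← Nat.sub_mul]; exact Nat.le_mul_of_pos_left _ (by omega))

/-- `|F1Str w| ≤ t·blk` on every input. [folklore] -/
theorem length_F1Str_le (w : List Bool) : (F1Str f n w).length ≤ t n * blk n :=
  length_ccat_le' _ fun _ _ => length_blockStr_le _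

/-- `|F2Str v| = m₂` on inputs of length at least `n₂`. [folklore] -/
theorem length_F2Str {j : ℕ} {v : List Bool} (hv : n2 n ≤ v.length) : (F2Str f n j v).length = m2 n := by
  have ht : (v.take (t n * d0 n)).length = t n * d0 n := by rw [List.length_take, min_eq_left]; unfold n2 at hv; omega
  simp only [F2Str, List.length_append, length_F1Str ht, length_fitLen, List.length_take, List.length_drop, m2]
  unfold n2 at hv; omega

/-- `|F2Str v| ≤ m₂` on every input. [folklore] -/
theorem length_F2Str_le (j : ℕ) (v : List Bool) : (F2Str f n j v).length ≤ m2 n := by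
  simp only [F2Str, List.length_append, length_fitLen, List.length_take, m2]
  have := length_F1Str_le (f := f) (n := n) (v.take (t n * d0 n)); omega

/-- `|F3Str v| = N − 1` on inputs of length at least `N`. [folklore] -/
theorem length_F3Str {j : ℕ} {v : List Bool} (hv : N n ≤ v.length) : (F3Str f n j v).length = Nm1 n := by
  simp only [F3Str, List.length_append, List.length_take, List.length_drop, length_hashStr, Nm1]
  unfold N at hv; omega

/-- `|F3Str v| ≤ N − 1` on every input. [folklore] -/
theorem length_F3Str_le (j : ℕ) (v : List Bool) : (F3Str f n j v).length ≤ Nm1 n := by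
  simp only [F3Str, List.length_append, List.length_take, length_hashStr, Nm1]; omega

/-- `|candStr y x| = N − 1` for `|y| = |x| = N`. [folklore] -/
theorem length_candStr {j : ℕ} {y x : List Bool} (hy : y.length = N n) (hx : x.length = N n) :
    (candStr f n j y x).length = Nm1 n :=
  length_F3Str (by rw [List.length_zipWith, hy, hx, min_self])

end Semantics

/-! ### Size bricks -/

/-- The compiled size expression `e`, reading `n` from field `0` (the unary `1ⁿ`) and `j` from field `1`
of its argument record. [folklore] -/
noncomputable def szF (e : UExpr) : List Bool → List Bool :=
  UExpr.compile (fun i => if i = 0 then nthF 0 else nthF 1) e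

/-- `szF e ∈ FP`. [folklore] -/
theorem szF_mem_FP (e : UExpr) : szF e ∈ FP :=
  compile_mem_FP (fun i => by
    by_cases hi : i = 0
    · rw [if_pos hi]; exact nthF_mem_FP 0
    · rw [if_neg hi]; exact nthF_mem_FP 1) e

/-- Value of a size brick on `⟨1ⁿ, p⟩`: `1^{e(n, |nthF 0 p|)}` — for the one-variable expressions of the
table this is `1^{e(n)}` by the `E.*_eval` bridges. [folklore] -/
theorem szF_boolPair (e : UExpr) (n : ℕ) (p : List Bool) :
    szF e (boolPair (ones n) p) = ones (e.eval fun i => if i = 0 then n else (nthF 0 p).length) := by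
  rw [szF, compile_apply]
  congr 1
  apply eval_congr
  intro i
  by_cases hi : i = 0
  · subst hi; simp [ones]
  · simp [hi]

/-- A polynomial bounding the one-variable size expression `e`. [folklore] -/
noncomputable def polyOf (e : UExpr) : Polynomial ℕ := Classical.choose (exists_poly_le₁ e)

/-- `e(n) ≤ polyOf e (L)` for `n ≤ L`. [folklore] -/
theorem eval_le_polyOf (e : UExpr) {n L : ℕ} (h : n ≤ L) : e.eval (fun _ => n) ≤ (polyOf e).eval L :=
  (Classical.choose_spec (exists_poly_le₁ e) n).trans (TM2Iter.eval_mono _ h)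

/-! ### The base block as a brick -/

section Bricks

open Literature.Computability.Learning (xorStrFn xorStrFn_apply xorStrFn_mem_FP ccat_singleton_eq_ofFn)

/-- Concatenation of the outputs of two bricks, point-free: `catF g h = appF ∘ ⟨g, h⟩`. [folklore] -/
noncomputable def catF (g h : List Bool → List Bool) : List Bool → List Bool := appF ∘ fanoutFn g h

/-- `catF g h z = g z ++ h z`. [folklore] -/
@[simp] theorem catF_apply (g h : List Bool → List Bool) (z : List Bool) : catF g h z = g z ++ h z := by
  simp [catF]

/-- `catF g h ∈ FP`. [folklore] -/
theorem catF_mem_FP {g h : List Bool → List Bool} (hg : g ∈ FP) (hh : h ∈ FP) : catF g h ∈ FP :=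
  comp_mem_FP appF_mem_FP (fanoutFn_mem_FP hg hh)

/-- `fitLen m` of a prefix of an `m`-bit string. [folklore] -/
theorem fitLen_take {m e : ℕ} {h : List Bool} (hl : h.length = m) : fitLen m (h.take e) = h.take e ++ List.replicate (m - e) false := by
  unfold fitLen
  rw [List.take_take, List.length_take, hl]
  by_cases he : e ≤ m
  · rw [min_eq_right he, min_eq_left he]
  · push Not at he
    rw [min_eq_left he.le, min_eq_right he.le, List.take_of_length_le hl.le, List.take_of_length_le (by omega),
      Nat.sub_self, Nat.sub_eq_zero_of_le he.le]

/-- `x = z ↾ n` from `⟨1ⁿ, z⟩`. [folklore] -/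
noncomputable def xbF : List Bool → List Bool := takeFn ∘ fanoutFn (szF (var 0)) sndF

/-- `κ = (z ⇂ n) ↾ ℓK` from `⟨1ⁿ, z⟩`. [folklore] -/
noncomputable def kbF : List Bool → List Bool := takeFn ∘ fanoutFn (szF E.lK) (dropFn ∘ fanoutFn (szF (var 0)) sndF)

/-- The `a` bits of `i` from `⟨1ⁿ, z⟩`. [folklore] -/
noncomputable def ibF : List Bool → List Bool :=
  takeFn ∘ fanoutFn (szF E.a) (dropFn ∘ fanoutFn (szF (add (var 0) E.lK)) sndF)

/-- `1ⁱ` from `⟨1ⁿ, z⟩` (the numeral of the `i`-bits, capped at `M`). [folklore] -/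
noncomputable def iuF : List Bool → List Bool := binToUnaryFn ∘ fanoutFn (szF E.M) ibF

/-- `h_κ(f x)` from `⟨1ⁿ, z⟩`. [folklore] -/
noncomputable def hF (f : List Bool → List Bool) : List Bool → List Bool :=
  AffineProg.hashFn ∘ fanoutFn (fanoutFn (szF (var 0)) (szF E.M)) (fanoutFn kbF (f ∘ xbF))

/-- **The base block brick** `blockP f ⟨1ⁿ, z⟩ = blockStr f n z`. [cite: HaitnerEtAl2020, Thm. 4.5] -/
noncomputable def blockP (f : List Bool → List Bool) : List Bool → List Bool :=
  catF (catF (takeFn ∘ fanoutFn iuF (hF f)) (Kannan.zerosFn ∘ dropFn ∘ fanoutFn iuF (szF E.M))) (catF kbF ibF)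

/-- Value of `xbF`. [folklore] -/
theorem xbF_boolPair (n : ℕ) (z : List Bool) : xbF (boolPair (ones n) z) = z.take n := by
  simp [xbF, szF_boolPair, ones]

/-- Value of `kbF`. [folklore] -/
theorem kbF_boolPair (n : ℕ) (z : List Bool) : kbF (boolPair (ones n) z) = (z.drop n).take (lK n) := by
  simp [kbF, szF_boolPair, ones]

/-- Value of `ibF`. [folklore] -/
theorem ibF_boolPair (n : ℕ) (z : List Bool) : ibF (boolPair (ones n) z) = (z.drop (n + lK n)).take (a n) := by
  simp [ibF, szF_boolPair, ones]

/-- The `i`-bits encode a number below `M`. [folklore] -/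
theorem bitsToNat_ib_lt (n : ℕ) (z : List Bool) : bitsToNat ((z.drop (n + lK n)).take (a n)) < M n := by
  refine (bitsToNat_lt _).trans_le (Nat.pow_le_pow_right (by norm_num) ?_)
  rw [List.length_take]; exact min_le_left _ _

/-- Value of `iuF`. [folklore] -/
theorem iuF_boolPair (n : ℕ) (z : List Bool) :
    iuF (boolPair (ones n) z) = ones (bitsToNat ((z.drop (n + lK n)).take (a n))) := by
  rw [iuF, Function.comp_apply, fanoutFn_apply, ibF_boolPair, szF_boolPair, binToUnaryFn_boolPair]
  simp only [E.M_eval, if_pos, List.length_replicate]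
  rw [min_eq_left (bitsToNat_ib_lt n z).le]

/-- Value of `hF`. [folklore] -/
theorem hF_boolPair (f : List Bool → List Bool) (n : ℕ) (z : List Bool) :
    hF f (boolPair (ones n) z) = hashStr n (M n) ((z.drop n).take (lK n)) (f (z.take n)) := by
  rw [hF, Function.comp_apply, fanoutFn_apply, fanoutFn_apply, fanoutFn_apply, Function.comp_apply, xbF_boolPair,
    kbF_boolPair, szF_boolPair, szF_boolPair]
  simp only [eval_var, if_pos, E.M_eval]
  exact AffineProg.hashFn_boolPair n (M n) _ _

/-- **`blockP f ⟨1ⁿ, z⟩ = blockStr f n z`** on every `z`. [cite: HaitnerEtAl2020, Thm. 4.5] -/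
theorem blockP_boolPair (f : List Bool → List Bool) (n : ℕ) (z : List Bool) :
    blockP f (boolPair (ones n) z) = blockStr f n z := by
  rw [blockP, catF_apply, catF_apply, catF_apply, Function.comp_apply, Function.comp_apply, Function.comp_apply,
    fanoutFn_apply, fanoutFn_apply, iuF_boolPair, hF_boolPair, kbF_boolPair, ibF_boolPair, szF_boolPair,
    takeFn_boolPair, dropFn_boolPair, Kannan.zerosFn_apply, blockStr, fitLen_take (length_hashStr _ _ _ _)]
  simp only [E.M_eval, if_pos, List.length_replicate, List.length_drop]

/-- `blockP f ∈ FP` for `f ∈ FP`. [cite: HaitnerEtAl2020, proof of Thm. 5.1 ("polynomial-time computable")] -/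
theorem blockP_mem_FP {f : List Bool → List Bool} (hf : f ∈ FP) : blockP f ∈ FP := by
  have hxb : xbF ∈ FP := comp_mem_FP takeFn_mem_FP (fanoutFn_mem_FP (szF_mem_FP _) sndF_mem_FP)
  have hkb : kbF ∈ FP := comp_mem_FP takeFn_mem_FP (fanoutFn_mem_FP (szF_mem_FP _)
    (comp_mem_FP dropFn_mem_FP (fanoutFn_mem_FP (szF_mem_FP _) sndF_mem_FP)))
  have hib : ibF ∈ FP := comp_mem_FP takeFn_mem_FP (fanoutFn_mem_FP (szF_mem_FP _)
    (comp_mem_FP dropFn_mem_FP (fanoutFn_mem_FP (szF_mem_FP _) sndF_mem_FP)))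
  have hiu : iuF ∈ FP := comp_mem_FP binToUnaryFn_mem_FP (fanoutFn_mem_FP (szF_mem_FP _) hib)
  have hh : hF f ∈ FP := comp_mem_FP AffineProg.hashFn_mem_FP
    (fanoutFn_mem_FP (fanoutFn_mem_FP (szF_mem_FP _) (szF_mem_FP _)) (fanoutFn_mem_FP hkb (comp_mem_FP hf hxb)))
  exact catF_mem_FP (catF_mem_FP (comp_mem_FP takeFn_mem_FP (fanoutFn_mem_FP hiu hh))
    (comp_mem_FP Kannan.zerosFn_mem_FP (comp_mem_FP dropFn_mem_FP (fanoutFn_mem_FP hiu (szF_mem_FP _)))))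
    (catF_mem_FP hkb hib)

/-! ### Step 1 as a brick -/

/-- Block `b` of `w`: `⟨⟨1ⁿ, w⟩, 1ᵇ⟩ ↦ ⟨1ⁿ, (w ⇂ b·d₀) ↾ d₀⟩`. [folklore] -/
noncomputable def pieceArgF : List Bool → List Bool :=
  fanoutFn (fstF ∘ fstF) (takeFn ∘ fanoutFn (szF E.d0 ∘ fstF)
    (dropFn ∘ fanoutFn (HashBricks.umulFn ∘ fanoutFn sndF (szF E.d0 ∘ fstF)) (sndF ∘ fstF)))

/-- Value of `pieceArgF`. [folklore] -/
theorem pieceArgF_apply (n b : ℕ) (w : List Bool) :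
    pieceArgF (boolPair (boolPair (ones n) w) (ones b)) = boolPair (ones n) ((w.drop (b * d0 n)).take (d0 n)) := by
  simp [pieceArgF, szF_boolPair, ones]

/-- `pieceArgF ∈ FP`. [folklore] -/
theorem pieceArgF_mem_FP : pieceArgF ∈ FP :=
  fanoutFn_mem_FP (comp_mem_FP fstF_mem_FP fstF_mem_FP) (comp_mem_FP takeFn_mem_FP (fanoutFn_mem_FP
    (comp_mem_FP (szF_mem_FP _) fstF_mem_FP) (comp_mem_FP dropFn_mem_FP (fanoutFn_mem_FP
      (comp_mem_FP HashBricks.umulFn_mem_FP (fanoutFn_mem_FP sndF_mem_FP (comp_mem_FP (szF_mem_FP _) fstF_mem_FP)))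
      (comp_mem_FP sndF_mem_FP fstF_mem_FP)))))

/-- **The Step-1 brick** `F1P f ⟨1ⁿ, w⟩ = F1Str f n w`: a concatenation fold of `t` base blocks.
[cite: HaitnerEtAl2020, proof of Thm. 5.1, Step 1] -/
noncomputable def F1P (f : List Bool → List Bool) : List Bool → List Bool :=
  foldCat (polyOf E.blk) (polyOf E.t) (blockP f ∘ pieceArgF) ∘ fanoutFn id (szF E.t)

/-- **`F1P f ⟨1ⁿ, w⟩ = F1Str f n w`** on every `w`. [cite: HaitnerEtAl2020, proof of Thm. 5.1, Step 1] -/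
theorem F1P_boolPair (f : List Bool → List Bool) (n : ℕ) (w : List Bool) : F1P f (boolPair (ones n) w) = F1Str f n w := by
  have hn : n ≤ (boolPair (ones n) w).length := by rw [length_boolPair]; simp [ones]; omega
  rw [F1P, Function.comp_apply, fanoutFn_apply, id, szF_boolPair]
  simp only [E.t_eval, if_pos]
  rw [foldCat_apply]
  · simp only [List.length_replicate, Function.comp_apply, pieceArgF_apply, blockP_boolPair]; rfl
  · rw [List.length_replicate]; exact eval_le_polyOf E.t hn
  · intro b _
    rw [Function.comp_apply, pieceArgF_apply, blockP_boolPair]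
    exact (length_blockStr_le _).trans (eval_le_polyOf E.blk hn)

/-- `F1P f ∈ FP` for `f ∈ FP`. [cite: HaitnerEtAl2020, proof of Thm. 5.1, Step 1] -/
theorem F1P_mem_FP {f : List Bool → List Bool} (hf : f ∈ FP) : F1P f ∈ FP :=
  comp_mem_FP (foldCat_mem_FP _ _ (comp_mem_FP (blockP_mem_FP hf) pieceArgF_mem_FP))
    (fanoutFn_mem_FP (PolyTimeComputable.id _) (szF_mem_FP _))

/-! ### Steps 2–4 as bricks (records `⟨1ⁿ, ⟨1ʲ, v⟩⟩`) -/

/-- `w = v ↾ t·d₀`. [folklore] -/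
noncomputable def wF : List Bool → List Bool := takeFn ∘ fanoutFn (szF (mul E.t E.d0)) (sndPow 1)

/-- `g₂ = (v ⇂ t·d₀) ↾ |G₂|`. [folklore] -/
noncomputable def g2F : List Bool → List Bool :=
  takeFn ∘ fanoutFn (szF E.G2) (dropFn ∘ fanoutFn (szF (mul E.t E.d0)) (sndPow 1))

/-- The padded smoothing hash `g₂(w) 0^{ℓmax − ℓ_j}` (cut to `ℓmax` symbols). [cite: HaitnerEtAl2020, proof of Thm. 5.1, Step 2] -/
noncomputable def h2F : List Bool → List Bool :=
  catF (takeFn ∘ fanoutFn (szF E.lmax) (AffineProg.hashFn ∘ fanoutFn (fanoutFn (szF (mul E.t E.d0)) (szF E.ell)) (fanoutFn g2F wF)))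
    (Kannan.zerosFn ∘ dropFn ∘ fanoutFn (szF E.ell) (szF E.lmax))

/-- **The Step-2 brick** `F2P f ⟨1ⁿ, ⟨1ʲ, v⟩⟩ = F2Str f n j v`. [cite: HaitnerEtAl2020, proof of Thm. 5.1, Step 2] -/
noncomputable def F2P (f : List Bool → List Bool) : List Bool → List Bool :=
  catF (F1P f ∘ fanoutFn (nthF 0) wF) (catF g2F h2F)

/-- `u = v ↾ n₂`. [folklore] -/
noncomputable def uF : List Bool → List Bool := takeFn ∘ fanoutFn (szF E.n2) (sndPow 1)

/-- `g₃ = (v ⇂ n₂) ↾ |G₃|`. [folklore] -/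
noncomputable def g3F : List Bool → List Bool :=
  takeFn ∘ fanoutFn (szF E.G3) (dropFn ∘ fanoutFn (szF E.n2) (sndPow 1))

/-- **The Step-3 brick** `F3P f ⟨1ⁿ, ⟨1ʲ, v⟩⟩ = F3Str f n j v`. [cite: HaitnerEtAl2020, proof of Thm. 5.1, Step 3] -/
noncomputable def F3P (f : List Bool → List Bool) : List Bool → List Bool :=
  catF g3F (AffineProg.hashFn ∘ fanoutFn (fanoutFn (szF E.m2) (szF E.r3))
    (fanoutFn g3F (F2P f ∘ fanoutFn (nthF 0) (fanoutFn (nthF 1) uF))))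

/-- **The Step-4 brick** `candP f ⟨1ⁿ, ⟨1ʲ, ⟨y, x⟩⟩⟩ = candStr f n j y x` (for `|y| ≤ |x|`).
[cite: HaitnerEtAl2020, proof of Thm. 5.1, Step 4] -/
noncomputable def candP (f : List Bool → List Bool) : List Bool → List Bool :=
  F3P f ∘ fanoutFn (nthF 0) (fanoutFn (nthF 1) (xorStrFn ∘ sndPow 1))

/-- Sizes on a two-field record. [folklore] -/
theorem szF_boolPair₂ (e : UExpr) (n j : ℕ) (v : List Bool) :
    szF e (boolPair (ones n) (boolPair (ones j) v)) = ones (e.eval fun i => if i = 0 then n else j) := by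
  rw [szF_boolPair]; simp [ones]

/-- Value of `wF`. [folklore] -/
theorem wF_apply (n j : ℕ) (v : List Bool) : wF (boolPair (ones n) (boolPair (ones j) v)) = v.take (t n * d0 n) := by
  rw [wF, Function.comp_apply, fanoutFn_apply, szF_boolPair₂]; simp [ones]

/-- Value of `g2F`. [folklore] -/
theorem g2F_apply (n j : ℕ) (v : List Bool) :
    g2F (boolPair (ones n) (boolPair (ones j) v)) = (v.drop (t n * d0 n)).take (G2 n) := by
  rw [g2F, Function.comp_apply, fanoutFn_apply, Function.comp_apply, fanoutFn_apply, szF_boolPair₂, szF_boolPair₂]; simp [ones]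

/-- Value of `h2F`. [folklore] -/
theorem h2F_apply (n j : ℕ) (v : List Bool) :
    h2F (boolPair (ones n) (boolPair (ones j) v)) =
      fitLen (lmax n) (hashStr (t n * d0 n) (ell n j) ((v.drop (t n * d0 n)).take (G2 n)) (v.take (t n * d0 n))) := by
  rw [h2F, catF_apply, Function.comp_apply, fanoutFn_apply, Function.comp_apply, fanoutFn_apply, fanoutFn_apply,
    fanoutFn_apply, Function.comp_apply, Function.comp_apply, fanoutFn_apply, szF_boolPair₂, szF_boolPair₂, szF_boolPair₂,
    g2F_apply, wF_apply, AffineProg.hashFn_boolPair, takeFn_boolPair, dropFn_boolPair, Kannan.zerosFn_apply, fitLen]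
  simp [ones]

/-- **`F2P f ⟨1ⁿ, ⟨1ʲ, v⟩⟩ = F2Str f n j v`** on every `v`. [cite: HaitnerEtAl2020, proof of Thm. 5.1, Step 2] -/
theorem F2P_apply (f : List Bool → List Bool) (n j : ℕ) (v : List Bool) :
    F2P f (boolPair (ones n) (boolPair (ones j) v)) = F2Str f n j v := by
  rw [F2P, catF_apply, catF_apply, Function.comp_apply, fanoutFn_apply, nthF_zero_boolPair, wF_apply, F1P_boolPair,
    g2F_apply, h2F_apply, F2Str]

/-- Value of `uF`. [folklore] -/
theorem uF_apply (n j : ℕ) (v : List Bool) : uF (boolPair (ones n) (boolPair (ones j) v)) = v.take (n2 n) := by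
  rw [uF, Function.comp_apply, fanoutFn_apply, szF_boolPair₂]; simp [ones]

/-- Value of `g3F`. [folklore] -/
theorem g3F_apply (n j : ℕ) (v : List Bool) :
    g3F (boolPair (ones n) (boolPair (ones j) v)) = (v.drop (n2 n)).take (G3 n) := by
  rw [g3F, Function.comp_apply, fanoutFn_apply, Function.comp_apply, fanoutFn_apply, szF_boolPair₂, szF_boolPair₂]; simp [ones]

/-- **`F3P f ⟨1ⁿ, ⟨1ʲ, v⟩⟩ = F3Str f n j v`** on every `v`. [cite: HaitnerEtAl2020, proof of Thm. 5.1, Step 3] -/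
theorem F3P_apply (f : List Bool → List Bool) (n j : ℕ) (v : List Bool) :
    F3P f (boolPair (ones n) (boolPair (ones j) v)) = F3Str f n j v := by
  rw [F3P, catF_apply, Function.comp_apply, fanoutFn_apply, fanoutFn_apply, fanoutFn_apply, Function.comp_apply,
    fanoutFn_apply, fanoutFn_apply, g3F_apply, szF_boolPair₂, szF_boolPair₂, nthF_zero_boolPair, nthF_succ_boolPair,
    nthF_zero_boolPair, uF_apply, F2P_apply, AffineProg.hashFn_boolPair, F3Str]
  simp

/-- `xorStrFn ⟨y, x⟩` is the pointwise `xor` when `|y| ≤ |x|`. [folklore] -/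
theorem xorStrFn_boolPair_eq_zipWith {y x : List Bool} (h : y.length ≤ x.length) :
    xorStrFn (boolPair y x) = List.zipWith xor y x := by
  rw [xorStrFn_apply, fstF_boolPair, sndF_boolPair, ccat_singleton_eq_ofFn]
  apply List.ext_getElem
  · rw [List.length_ofFn, List.length_zipWith, min_eq_left h]
  · intro p h1 h2
    rw [List.length_ofFn] at h1
    rw [List.getElem_ofFn, List.getElem_zipWith]
    have hx : p < x.length := by omega
    rw [List.drop_eq_getElem_cons h1, List.drop_eq_getElem_cons hx]
    rfl

/-- **`candP f ⟨1ⁿ, ⟨1ʲ, ⟨y, x⟩⟩⟩ = candStr f n j y x`** for `|y| ≤ |x|` (in particular for `|y| = |x| = N`).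
[cite: HaitnerEtAl2020, proof of Thm. 5.1, Step 4] -/
theorem candP_apply (f : List Bool → List Bool) (n j : ℕ) {y x : List Bool} (h : y.length ≤ x.length) :
    candP f (boolPair (ones n) (boolPair (ones j) (boolPair y x))) = candStr f n j y x := by
  rw [candP, Function.comp_apply, fanoutFn_apply, fanoutFn_apply, Function.comp_apply, nthF_zero_boolPair,
    nthF_succ_boolPair, nthF_zero_boolPair, sndPow_succ_boolPair, sndPow_zero_boolPair, xorStrFn_boolPair_eq_zipWith h,
    F3P_apply, candStr]

/-- `F2P f ∈ FP` for `f ∈ FP`. [cite: HaitnerEtAl2020, proof of Thm. 5.1, Step 2] -/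
theorem F2P_mem_FP {f : List Bool → List Bool} (hf : f ∈ FP) : F2P f ∈ FP := by
  have hw : wF ∈ FP := comp_mem_FP takeFn_mem_FP (fanoutFn_mem_FP (szF_mem_FP _) (sndPow_mem_FP 1))
  have hg : g2F ∈ FP := comp_mem_FP takeFn_mem_FP (fanoutFn_mem_FP (szF_mem_FP _)
    (comp_mem_FP dropFn_mem_FP (fanoutFn_mem_FP (szF_mem_FP _) (sndPow_mem_FP 1))))
  have hh : h2F ∈ FP := catF_mem_FP
    (comp_mem_FP takeFn_mem_FP (fanoutFn_mem_FP (szF_mem_FP _) (comp_mem_FP AffineProg.hashFn_mem_FP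
      (fanoutFn_mem_FP (fanoutFn_mem_FP (szF_mem_FP _) (szF_mem_FP _)) (fanoutFn_mem_FP hg hw)))))
    (comp_mem_FP Kannan.zerosFn_mem_FP (comp_mem_FP dropFn_mem_FP (fanoutFn_mem_FP (szF_mem_FP _) (szF_mem_FP _))))
  exact catF_mem_FP (comp_mem_FP (F1P_mem_FP hf) (fanoutFn_mem_FP (nthF_mem_FP 0) hw)) (catF_mem_FP hg hh)

/-- `F3P f ∈ FP` for `f ∈ FP`. [cite: HaitnerEtAl2020, proof of Thm. 5.1, Step 3] -/
theorem F3P_mem_FP {f : List Bool → List Bool} (hf : f ∈ FP) : F3P f ∈ FP := by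
  have hu : uF ∈ FP := comp_mem_FP takeFn_mem_FP (fanoutFn_mem_FP (szF_mem_FP _) (sndPow_mem_FP 1))
  have hg : g3F ∈ FP := comp_mem_FP takeFn_mem_FP (fanoutFn_mem_FP (szF_mem_FP _)
    (comp_mem_FP dropFn_mem_FP (fanoutFn_mem_FP (szF_mem_FP _) (sndPow_mem_FP 1))))
  exact catF_mem_FP hg (comp_mem_FP AffineProg.hashFn_mem_FP
    (fanoutFn_mem_FP (fanoutFn_mem_FP (szF_mem_FP _) (szF_mem_FP _)) (fanoutFn_mem_FP hg
      (comp_mem_FP (F2P_mem_FP hf) (fanoutFn_mem_FP (nthF_mem_FP 0) (fanoutFn_mem_FP (nthF_mem_FP 1) hu))))))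

/-- `candP f ∈ FP` for `f ∈ FP`. [cite: HaitnerEtAl2020, proof of Thm. 5.1, Step 4] -/
theorem candP_mem_FP {f : List Bool → List Bool} (hf : f ∈ FP) : candP f ∈ FP :=
  comp_mem_FP (F3P_mem_FP hf) (fanoutFn_mem_FP (nthF_mem_FP 0) (fanoutFn_mem_FP (nthF_mem_FP 1)
    (comp_mem_FP xorStrFn_mem_FP (sndPow_mem_FP 1))))

end Bricks

end HHRVW

end Literature.Computability.Cryptography
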